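import Literature.NumberTheory.EllipticCurves.SzpiroHallProofs

/-!
# Crux `PolyHeightOfBoundedPrimes` (stmt-ABC-16006), line `Sketch` (idea `mordell-twist-cm-height`):
the glue stub `stub_polyGenSzpiro_of_polyStrongHall` — polynomial strong Hall ⟹ polynomial
generalized Szpiro over `ℤ`-models

The line (lead skeleton `Cruxes/PolyHeightOfBoundedPrimes/Lines/Sketch.lean`) transfers the crux
`B′ = A → H` (`H` = polynomial height conjecture for semistable globally minimal `W/ℚ`, exponent free)
to C⁺ = **polynomial strong Hall**: every primitive solution of `x³ − y² = z ≠ 0` (Bombieri–Gubler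
12.5.2, `IsPrimitiveHallSolution`) satisfies `max(|x|³, |z|) ≤ C · rad(z)^A` for absolute `A, C`.

This file proves the registered GLUE stub of the cone:

* `stub_polyGenSzpiro_of_polyStrongHall` — C⁺ ⟹ **polynomial generalized Szpiro over `ℤ`-models**
  (Bombieri–Gubler Conj. 12.5.11 with the exponent `6 + ε` replaced by a free `σ`): for every
  `W₀ : WeierstrassCurve ℤ` elliptic over `ℚ` and minimal at every place,
  `max(|Δ|, |c₄|³) ≤ C' · N^σ`, with `σ := max A 6`.

The proof is Bombieri–Gubler's printed proof of Theorem 12.5.12 (b) ⟹ (c) (pp. 432–433) with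
`6 + ε ↦ e := max A 6`, a line-by-line adaptation of the tree theorem
`Literature.NumberTheory.EllipticCurves.generalizedSzpiroBG_of_strongHall` (`SzpiroHallProofs`):
write `Γ = gcd(c₄³, c₆²) = Γ′ g⁶` (`exists_factorization_eq_div_six`), so `g² ∣ c₄`, `g³ ∣ c₆`
(`pow_natCast_dvd_of_factorization_le`) and `(x, y, z) = (c₄/g², c₆/g³, 1728Δ/g⁶)` is a primitive
solution of `x³ − y² = z` (`WeierstrassCurve.c_relation`); the hypothesis gives
`max(|x|³, |z|) ≤ C rad(z)^A`, hence `|x|³ ≤ C' rad(z)^A` and `|y|² = |x³ − z| ≤ C' rad(z)^A` with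
`C' = 2 max(C, 1)`; `rad(z) ≤ 1728 rad(Δ)`; Corollary 12.5.7 (`not_pow_dvd_c₄_c₆_of_isMinimalAt{,_two,_three}`,
`factorization_gcd_le_of_not_pow_dvd`, `dvd_mul_radical_of_factorization_le`) gives `g ∣ 72 rad(g)`;
and `rad(g) rad(Δ) ∣ 6 N` (a prime `p ≥ 5` dividing `g` divides `c₄`, `c₆`, `Δ`, so is additive,
`f_p ≥ 2`: `two_le_conductorExponent_of_dvd_Δ_of_dvd_c₄`; `p ∣ Δ ⟹ f_p ≥ 1`:
`conductorExponent_ne_zero_of_dvd_Δ`; `factorization_conductorNorm_holds`). With `1 ≤ rad`,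
`A ≤ e` and `6 ≤ e` one gets `|c₄|³, |c₆|² ≤ K N^e`, `K = 72⁶ · C' · (1728·6)^e`, and finally
`|Δ| ≤ (|c₄|³ + |c₆|²)/1728 ≤ 2 K N^e`.

Supports stmt-ABC-16006 (registered stub, name and signature verbatim; curried corollary
`polyGenSzpiro_of_polyStrongHall`).

References: E. Bombieri, W. Gubler, *Heights in Diophantine Geometry*, New Math. Monogr. 4,
Cambridge Univ. Press 2006, 12.5.2–12.5.3, 12.5.5–12.5.9, Conj. 12.5.11, Theorem 12.5.12,
proof (b) ⟹ (c), pp. 425–433 [BombieriGubler2006].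
-/

noncomputable section

-- single-conjunct summit ABC: the duplicate ABC.ABC is mandated (CONVENTIONS §2)
set_option linter.dupNamespace false

namespace Summit.ABC.ABC.Theorems.PolyHeightOfBoundedPrimes.MordellTwist

open UniqueFactorizationMonoid IsDedekindDomain Real WeierstrassCurve Rat.HeightOneSpectrum
open Literature.NumberTheory.DiophantineGeometry Literature.NumberTheory.EllipticCurves

/-- **Registered stub `stub_polyGenSzpiro_of_polyStrongHall`** (Bombieri–Gubler, Theorem 12.5.12,
(b) ⟹ (c), with a free exponent). Polynomial strong Hall — every primitive solution of
`x³ − y² = z ≠ 0` has `max(|x|³, |z|) ≤ C · rad(z)^A` — implies polynomial generalized Szpiro over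
`ℤ`-models minimal at every place: `max(|Δ|, |c₄|³) ≤ C' · N^σ` with `σ = max A 6` and
`C' = 2 · 72⁶ · 2 max(C,1) · 10368^σ`. Printed proof: `Γ := gcd(c₄³, c₆²) = Γ′ g⁶` with `Γ′`
sixth-power free; by (12.11) `1728 Δ/g⁶ = (c₄/g²)³ − (c₆/g³)²` is a primitive solution, so the
hypothesis gives `|c₄|³, |c₆|² ≤ 2 max(C,1) g⁶ rad(1728Δ/g⁶)^A`; by Corollary 12.5.7 `g ≤ 72 rad(g)`;
a prime `p ≠ 2, 3` dividing `c₄` and `c₆` is a prime of additive reduction, `f_p ≥ 2` (12.5.5,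
12.5.9), so `rad(Δ) rad(g) ≤ 6 N`; finally `|Δ| ≤ (|c₄|³ + |c₆|²)/1728`. Adapted from the tree
theorem `generalizedSzpiroBG_of_strongHall`. [cite: BombieriGubler2006, Thm. 12.5.12 (b) ⟹ (c)] -/
theorem stub_polyGenSzpiro_of_polyStrongHall :
    (∃ A C : ℝ, ∀ x y z : ℤ, IsPrimitiveHallSolution x y z →
      ((max (|x| ^ 3) |z| : ℤ) : ℝ) ≤ C * ((radical z.natAbs : ℕ) : ℝ) ^ A) →
    ∃ σ C : ℝ, ∀ W₀ : WeierstrassCurve ℤ, (W₀.baseChange ℚ).IsElliptic →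
      (∀ v : HeightOneSpectrum ℤ, (W₀.baseChange ℚ).IsMinimalAt v) →
      ((max |W₀.Δ| (|W₀.c₄| ^ 3) : ℤ) : ℝ) ≤ C * ((W₀.baseChange ℚ).conductorNorm ℤ : ℝ) ^ σ := by
  rintro ⟨A, C₀, hC₀⟩
  -- constants: `C' = max C₀ 1`, `C = 2 C'`, exponent `e = max A 6`, `K = 72⁶ C (1728·6)^e`
  set C' : ℝ := max C₀ 1 with hC'def
  have hC'1 : 1 ≤ C' := le_max_right _ _
  have hC'0 : 0 ≤ C' := zero_le_one.trans hC'1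
  set C : ℝ := 2 * C' with hCdef
  have hC0 : 0 < C := by rw [hCdef]; linarith
  set e : ℝ := max A 6 with hedef
  have hAe : A ≤ e := le_max_left _ _
  have h6e : (6 : ℝ) ≤ e := le_max_right _ _
  have he0 : 0 ≤ e := by linarith
  set K : ℝ := 72 ^ 6 * C * (1728 * 6) ^ e with hKdef
  have hK0 : 0 ≤ K := by positivity
  refine ⟨e, 2 * K, fun W₀ hE hmin ↦ ?_⟩
  haveI := hE
  set c₄ : ℤ := W₀.c₄ with hc₄
  set c₆ : ℤ := W₀.c₆ with hc₆
  set Δ : ℤ := W₀.Δ with hΔ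
  have hΔ0 : Δ ≠ 0 := Δ_ne_zero_of_isElliptic_baseChange_int W₀
  have hrel : 1728 * Δ = c₄ ^ 3 - c₆ ^ 2 := W₀.c_relation
  -- `Γ = GCD (c₄³, c₆²) = Γ' g⁶`
  set Γ : ℕ := Int.gcd (c₄ ^ 3) (c₆ ^ 2) with hΓdef
  have hΓ0 : Γ ≠ 0 := by
    intro h
    rw [hΓdef, Int.gcd_eq_zero_iff] at h
    apply hΔ0
    have : (1728 : ℤ) * Δ = 0 := by rw [hrel, h.1, h.2, sub_zero]
    simpa using this
  obtain ⟨g, hg0, hgfac⟩ := exists_factorization_eq_div_six Γ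
  have hΓc₄ : (Γ : ℤ) ∣ c₄ ^ 3 := Int.gcd_dvd_left _ _
  have hΓc₆ : (Γ : ℤ) ∣ c₆ ^ 2 := Int.gcd_dvd_right _ _
  -- `g² ∣ c₄`, `g³ ∣ c₆`
  have hfacΓ : ∀ {c : ℤ} {n : ℕ}, c ≠ 0 → (Γ : ℤ) ∣ c ^ n → ∀ p : ℕ, p.Prime →
      Γ.factorization p ≤ n * c.natAbs.factorization p := by
    intro c n hc hdvd p hp
    have hcn : c.natAbs ≠ 0 := Int.natAbs_ne_zero.mpr hc
    have hdvd' : Γ ∣ c.natAbs ^ n := by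
      rw [← Int.natAbs_pow]; exact Int.natCast_dvd.mp hdvd
    have hle := Nat.factorization_le_factorization_of_dvd_right hdvd' hΓ0
      (pow_ne_zero _ hcn) (a := p)
    rw [Nat.factorization_pow] at hle
    simpa using hle
  have hg2 : (g : ℤ) ^ 2 ∣ c₄ := by
    by_cases h0 : c₄ = 0
    · rw [h0]; exact dvd_zero _
    refine pow_natCast_dvd_of_factorization_le hg0 h0 fun p hp ↦ ?_
    have := hfacΓ h0 hΓc₄ p hp
    rw [hgfac]; omega
  have hg3 : (g : ℤ) ^ 3 ∣ c₆ := by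
    by_cases h0 : c₆ = 0
    · rw [h0]; exact dvd_zero _
    refine pow_natCast_dvd_of_factorization_le hg0 h0 fun p hp ↦ ?_
    have := hfacΓ h0 hΓc₆ p hp
    rw [hgfac]; omega
  obtain ⟨x, hx⟩ := hg2
  obtain ⟨y, hy⟩ := hg3
  set z : ℤ := x ^ 3 - y ^ 2 with hzdef
  have hg0' : (g : ℤ) ≠ 0 := by exact_mod_cast hg0
  have hgz : (g : ℤ) ^ 6 * z = 1728 * Δ := by rw [hrel, hx, hy, hzdef]; ring
  have hz0 : z ≠ 0 := by
    intro h
    rw [h, mul_zero] at hgz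
    exact hΔ0 (by simpa using hgz.symm)
  -- primitivity of `(x, y, z)`
  have hΓ' : Γ = g ^ 6 * Int.gcd (x ^ 3) (y ^ 2) := by
    rw [hΓdef, hx, hy, mul_pow, mul_pow, ← pow_mul, ← pow_mul, Int.gcd_mul_left,
      Int.natAbs_pow, Int.natAbs_natCast]
  have hprim : IsPrimitiveHallSolution x y z := by
    refine ⟨rfl, hz0, fun d hd ↦ ?_⟩
    set Γ₁ := Int.gcd (x ^ 3) (y ^ 2) with hΓ₁
    have hΓ₁0 : Γ₁ ≠ 0 := by
      intro h; exact hΓ0 (by rw [hΓ', h, mul_zero])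
    by_contra hd1
    have hd0 : d ≠ 0 := by
      rintro rfl
      exact hΓ₁0 (Nat.eq_zero_of_zero_dvd (by simpa using hd))
    obtain ⟨q, hq, hqd⟩ := Nat.exists_prime_and_dvd hd1
    have hq6 : q ^ 6 ∣ Γ₁ := dvd_trans (pow_dvd_pow_of_dvd hqd 6) hd
    have h6 : 6 ≤ Γ₁.factorization q := (hq.pow_dvd_iff_le_factorization hΓ₁0).mp hq6
    have hfac : Γ.factorization q = 6 * g.factorization q + Γ₁.factorization q := by
      rw [hΓ', Nat.factorization_mul (pow_ne_zero _ hg0) hΓ₁0, Nat.factorization_pow]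
      simp
    have := hgfac q
    omega
  -- the polynomial strong Hall hypothesis for `(x, y, z)`
  have hH := hC₀ x y z hprim
  set Rz : ℝ := ((radical z.natAbs : ℕ) : ℝ) with hRz
  have hRz0 : 0 ≤ Rz := by positivity
  have hRz1 : 1 ≤ Rz := by rw [hRz]; exact_mod_cast Nat.radical_pos _
  have hH' : max (|(x : ℝ)| ^ 3) |(z : ℝ)| ≤ C' * Rz ^ A := by
    have h := hH.trans (mul_le_mul_of_nonneg_right (le_max_left C₀ 1) (by positivity))
    rwa [Int.cast_max, Int.cast_pow, Int.cast_abs, Int.cast_abs] at h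
  have hHx : |(x : ℝ)| ^ 3 ≤ C' * Rz ^ A := (le_max_left _ _).trans hH'
  have hHz : |(z : ℝ)| ≤ C' * Rz ^ A := (le_max_right _ _).trans hH'
  have hC'C : C' * Rz ^ A ≤ C * Rz ^ A :=
    mul_le_mul_of_nonneg_right (by rw [hCdef]; linarith) (by positivity)
  -- `|x|³ ≤ C rad(z)^A` and `|y|² = |x³ − z| ≤ |x|³ + |z| ≤ C rad(z)^A`
  have hHx3 : |(x : ℝ)| ^ 3 ≤ C * Rz ^ A := hHx.trans hC'C
  have hHy2 : |(y : ℝ)| ^ 2 ≤ C * Rz ^ A := by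
    have hyeq : (y : ℝ) ^ 2 = (x : ℝ) ^ 3 - (z : ℝ) := by rw [hzdef]; push_cast; ring
    calc |(y : ℝ)| ^ 2 = |(x : ℝ) ^ 3 - (z : ℝ)| := by rw [← abs_pow, hyeq]
      _ ≤ |(x : ℝ) ^ 3| + |(z : ℝ)| := abs_sub _ _
      _ = |(x : ℝ)| ^ 3 + |(z : ℝ)| := by rw [abs_pow]
      _ ≤ C' * Rz ^ A + C' * Rz ^ A := add_le_add hHx hHz
      _ = C * Rz ^ A := by rw [hCdef]; ring
  -- the radicals: `rad (z) ≤ 1728 rad (Δ)`, `g ≤ 72 rad (g)`, `rad (g) rad (Δ) ≤ 6 N`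
  set N : ℕ := (W₀.baseChange ℚ).conductorNorm ℤ with hNdef
  have hN0 : N ≠ 0 := (conductorNorm_pos_holds (W₀.baseChange ℚ)).ne'
  have hradz : radical z.natAbs ≤ 1728 * radical Δ.natAbs := by
    have hz' : z.natAbs ∣ 1728 * Δ.natAbs := by
      have : z ∣ 1728 * Δ := ⟨(g : ℤ) ^ 6, by rw [← hgz]; ring⟩
      simpa [Int.natAbs_mul] using Int.natAbs_dvd_natAbs.mpr this
    have h1 : radical z.natAbs ∣ radical 1728 * radical Δ.natAbs :=
      (radical_dvd_radical hz' (mul_ne_zero (by norm_num) (Int.natAbs_ne_zero.mpr hΔ0))).trans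
        radical_mul_dvd
    refine (Nat.le_of_dvd (by positivity) h1).trans ?_
    exact Nat.mul_le_mul_right _ (Nat.radical_le_self_iff.mpr (by norm_num))
  -- place above a rational prime
  have place : ∀ {p : ℕ} (_ : p.Prime), ∃ v : HeightOneSpectrum ℤ, natGenerator v = p :=
    fun {p} hp ↦ ⟨(primesEquiv (R := ℤ)).symm ⟨p, hp⟩,
      Literature.NumberTheory.EllipticCurves.Rat.natGenerator_primesEquiv_symm ⟨p, hp⟩⟩
  -- Corollary 12.5.7 ⟹ `v_p (g) ≤ 3, 2, 1`
  have hgle : ∀ p : ℕ, p.Prime →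
      g.factorization p ≤ if p = 2 then 3 else if p = 3 then 2 else 1 := by
    intro p hp
    obtain ⟨v, hv⟩ := place hp
    -- Corollary 12.5.7 (= Silverman AEC Ex. 8.21, `SzpiroMinimalityProofs`)
    have cor : ∀ {e₄ e₆ : ℕ}, ¬ ((p : ℤ) ^ (e₄ + 4) ∣ c₄ ∧ (p : ℤ) ^ (e₆ + 6) ∣ c₆) →
        Γ.factorization p ≤ max (3 * e₄ + 9) (2 * e₆ + 10) :=
      fun h ↦ factorization_gcd_le_of_not_pow_dvd (c₄ := c₄) (c₆ := c₆) hp (not_and_or.mp h)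
    rw [hgfac]
    by_cases h2 : p = 2
    · subst h2
      have := cor (e₄ := 4) (e₆ := 5)
        (not_pow_dvd_c₄_c₆_of_isMinimalAt_two v W₀ hΔ0 (hmin v) hv)
      rw [if_pos rfl]; omega
    by_cases h3 : p = 3
    · subst h3
      have := cor (e₄ := 1) (e₆ := 3)
        (not_pow_dvd_c₄_c₆_of_isMinimalAt_three v W₀ hΔ0 (hmin v) hv)
      rw [if_neg h2, if_pos rfl]; omega
    · have h5 : 5 ≤ p := by
        have := hp.two_le
        by_contra h; interval_cases p <;> first | exact absurd hp (by decide) | omega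
      have := cor (e₄ := 0) (e₆ := 0)
        (by simpa only [hv] using not_pow_dvd_c₄_c₆_of_isMinimalAt v W₀ hΔ0 (hmin v) (hv ▸ h5))
      rw [if_neg h2, if_neg h3]; omega
  have hg72 : g ≤ 72 * radical g :=
    Nat.le_of_dvd (by positivity) (dvd_mul_radical_of_factorization_le hg0 hgle)
  -- `rad (g) rad (Δ) ∣ 6 N` (12.5.5, 12.5.9)
  have hradN : radical g * radical Δ.natAbs ∣ 6 * N := by
    have hΔn : Δ.natAbs ≠ 0 := Int.natAbs_ne_zero.mpr hΔ0
    have hrg : radical g ≠ 0 := radical_ne_zero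
    have hrΔ : radical Δ.natAbs ≠ 0 := radical_ne_zero
    rw [← Nat.factorization_le_iff_dvd (mul_ne_zero hrg hrΔ) (mul_ne_zero (by norm_num) hN0)]
    intro p
    by_cases hp : p.Prime
    swap
    · simp [Nat.factorization_eq_zero_of_not_prime _ hp]
    obtain ⟨v, hv⟩ := place hp
    have hfN : N.factorization p = (W₀.baseChange ℚ).conductorExponent v := by
      rw [hNdef, ← hv]; exact factorization_conductorNorm_holds (W₀.baseChange ℚ) v
    rw [Nat.factorization_mul hrg hrΔ, Nat.factorization_mul (by norm_num) hN0, Finsupp.add_apply,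
      Finsupp.add_apply, factorization_radical_apply hg0 hp, factorization_radical_apply hΔn hp,
      hfN]
    -- `p ∣ Δ ⟹ f_p ≥ 1`
    have hbad : p ∣ Δ.natAbs → 1 ≤ (W₀.baseChange ℚ).conductorExponent v := by
      intro h
      have := conductorExponent_ne_zero_of_dvd_Δ (hmin v) (hv ▸ Int.natCast_dvd.mpr h)
      omega
    by_cases h23 : p = 2 ∨ p = 3
    · -- at `2` and `3` the factor `6` absorbs `rad (g)`
      have h6 : 1 ≤ (6 : ℕ).factorization p := by
        rcases h23 with rfl | rfl
        · rw [show (6 : ℕ) = 2 ^ 1 * 3 by norm_num, Nat.factorization_mul (by norm_num) (by norm_num),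
            Finsupp.add_apply, Nat.Prime.factorization_pow Nat.prime_two, Finsupp.single_eq_same]
          omega
        · rw [show (6 : ℕ) = 2 * 3 ^ 1 by norm_num, Nat.factorization_mul (by norm_num) (by norm_num),
            Finsupp.add_apply, Nat.Prime.factorization_pow Nat.prime_three, Finsupp.single_eq_same]
          omega
      split_ifs with hdg hdΔ hdΔ
      · have := hbad hdΔ; omega
      · omega
      · have := hbad hdΔ; omega
      · omega
    · push Not at h23
      have h5 : 5 ≤ p := by
        have := hp.two_le
        by_contra h; interval_cases p <;> first | exact absurd hp (by decide) | omega
      -- `p ∣ g ⟹ p ∣ c₄, p ∣ c₆ ⟹ p ∣ Δ`, additive reduction, `f_p ≥ 2`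
      have hpg : p ∣ g → 2 ≤ (W₀.baseChange ℚ).conductorExponent v := by
        intro hdvd
        have h1 : 1 ≤ g.factorization p := (hp.dvd_iff_one_le_factorization hg0).mp hdvd
        have hΓ6 : 6 ≤ Γ.factorization p := by have := hgfac p; omega
        have hpΓ : (p : ℤ) ∣ Γ :=
          Int.natCast_dvd_natCast.mpr ((hp.dvd_iff_one_le_factorization hΓ0).mpr (by omega))
        have hpint : Prime (p : ℤ) := Nat.prime_iff_prime_int.mp hp
        have hpc₄ : (p : ℤ) ∣ c₄ := hpint.dvd_of_dvd_pow (hpΓ.trans hΓc₄)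
        have hpc₆ : (p : ℤ) ∣ c₆ := hpint.dvd_of_dvd_pow (hpΓ.trans hΓc₆)
        have hpΔ : (p : ℤ) ∣ Δ := by
          have h1728 : (p : ℤ) ∣ 1728 * Δ := by
            rw [hrel]; exact dvd_sub (dvd_pow hpc₄ three_ne_zero) (dvd_pow hpc₆ two_ne_zero)
          rcases Int.Prime.dvd_mul hp h1728 with h | h
          · exact absurd h (by
              simpa using not_dvd_two_pow_mul_three_pow hp h5 6 3)
          · exact Int.natCast_dvd.mpr h
        exact two_le_conductorExponent_of_dvd_Δ_of_dvd_c₄ (hmin v) (hv ▸ hpΔ) (hv ▸ hpc₄)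
      have h6 : (6 : ℕ).factorization p = 0 := by
        apply Nat.factorization_eq_zero_of_not_dvd
        simpa using not_dvd_two_pow_mul_three_pow hp h5 1 1
      rw [h6, zero_add]
      split_ifs with hdg hdΔ hdΔ
      · have := hpg hdg; omega
      · have := hpg hdg; omega
      · exact hbad hdΔ
      · exact Nat.zero_le _
  -- real numbers
  set Rg : ℝ := ((radical g : ℕ) : ℝ) with hRg
  set RΔ : ℝ := ((radical Δ.natAbs : ℕ) : ℝ) with hRΔ
  set N' : ℝ := ((N : ℕ) : ℝ) with hN'
  have hRg1 : 1 ≤ Rg := by rw [hRg]; exact_mod_cast Nat.radical_pos g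
  have hRΔ1 : 1 ≤ RΔ := by rw [hRΔ]; exact_mod_cast Nat.radical_pos _
  have hRzle : Rz ≤ 1728 * RΔ := by rw [hRz, hRΔ]; exact_mod_cast hradz
  have hgle' : (g : ℝ) ≤ 72 * Rg := by rw [hRg]; exact_mod_cast hg72
  have hB : Rg * RΔ ≤ 6 * N' := by
    have h := Nat.le_of_dvd (by positivity) hradN
    rw [hRg, hRΔ, hN']
    exact_mod_cast h
  have hg6 : (g : ℝ) ^ 6 ≤ 72 ^ 6 * Rg ^ e := by
    calc (g : ℝ) ^ 6 ≤ (72 * Rg) ^ 6 := pow_le_pow_left₀ (by positivity) hgle' 6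
      _ = 72 ^ 6 * Rg ^ ((6 : ℕ) : ℝ) := by rw [mul_pow, Real.rpow_natCast]
      _ ≤ 72 ^ 6 * Rg ^ e :=
        mul_le_mul_of_nonneg_left (Real.rpow_le_rpow_of_exponent_le hRg1 (by exact_mod_cast h6e))
          (by positivity)
  -- the common estimate for `|c₄|³ = g⁶ |x|³` and `|c₆|² = g⁶ |y|²`
  have key : ∀ u : ℝ, 0 ≤ u → u ≤ C * Rz ^ A → (g : ℝ) ^ 6 * u ≤ K * N' ^ e := by
    intro u hu0 hu
    have h1 : u ≤ C * (1728 * RΔ) ^ e := by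
      calc u ≤ C * Rz ^ A := hu
        _ ≤ C * Rz ^ e :=
          mul_le_mul_of_nonneg_left (Real.rpow_le_rpow_of_exponent_le hRz1 hAe) hC0.le
        _ ≤ C * (1728 * RΔ) ^ e :=
          mul_le_mul_of_nonneg_left (Real.rpow_le_rpow hRz0 hRzle he0) hC0.le
    calc (g : ℝ) ^ 6 * u ≤ (72 ^ 6 * Rg ^ e) * (C * (1728 * RΔ) ^ e) :=
          mul_le_mul hg6 h1 hu0 (by positivity)
      _ = 72 ^ 6 * C * 1728 ^ e * (Rg * RΔ) ^ e := by
          rw [Real.mul_rpow (by norm_num) (by positivity),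
            Real.mul_rpow (by positivity) (by positivity)]
          ring
      _ ≤ 72 ^ 6 * C * 1728 ^ e * (6 * N') ^ e :=
          mul_le_mul_of_nonneg_left (Real.rpow_le_rpow (by positivity) hB he0) (by positivity)
      _ = K * N' ^ e := by
          rw [hKdef, Real.mul_rpow (by norm_num) (by positivity),
            Real.mul_rpow (by norm_num) (by norm_num)]
          ring
  have hc₄3 : |(c₄ : ℝ)| ^ 3 ≤ K * N' ^ e := by
    have h : |(c₄ : ℝ)| ^ 3 = (g : ℝ) ^ 6 * |(x : ℝ)| ^ 3 := by
      rw [hx]; push_cast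
      rw [abs_mul, abs_of_nonneg (by positivity : (0 : ℝ) ≤ (g : ℝ) ^ 2)]; ring
    rw [h]
    exact key _ (by positivity) hHx3
  have hc₆2 : |(c₆ : ℝ)| ^ 2 ≤ K * N' ^ e := by
    have h : |(c₆ : ℝ)| ^ 2 = (g : ℝ) ^ 6 * |(y : ℝ)| ^ 2 := by
      rw [hy]; push_cast
      rw [abs_mul, abs_of_nonneg (by positivity : (0 : ℝ) ≤ (g : ℝ) ^ 3)]; ring
    rw [h]
    exact key _ (by positivity) hHy2
  have hKN : 0 ≤ K * N' ^ e := by positivity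
  have hΔle : |(Δ : ℝ)| ≤ 2 * K * N' ^ e := by
    have hrel' : (1728 : ℝ) * Δ = (c₄ : ℝ) ^ 3 - (c₆ : ℝ) ^ 2 := by exact_mod_cast hrel
    calc |(Δ : ℝ)| ≤ |(1728 : ℝ) * Δ| := by
          rw [abs_mul]
          exact le_mul_of_one_le_left (abs_nonneg _) (by norm_num)
      _ = |(c₄ : ℝ) ^ 3 - (c₆ : ℝ) ^ 2| := by rw [hrel']
      _ ≤ |(c₄ : ℝ) ^ 3| + |(c₆ : ℝ) ^ 2| := abs_sub _ _
      _ = |(c₄ : ℝ)| ^ 3 + |(c₆ : ℝ)| ^ 2 := by rw [abs_pow, abs_pow]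
      _ ≤ K * N' ^ e + K * N' ^ e := add_le_add hc₄3 hc₆2
      _ = 2 * K * N' ^ e := by ring
  -- conclusion
  rw [Int.cast_max, Int.cast_pow, Int.cast_abs, Int.cast_abs]
  refine max_le hΔle (hc₄3.trans ?_)
  linarith

/-- Curried form of `stub_polyGenSzpiro_of_polyStrongHall`: polynomial strong Hall ⟹ polynomial
generalized Szpiro over `ℤ`-models minimal at every place (Bombieri–Gubler, Theorem 12.5.12,
(b) ⟹ (c), free exponent). [cite: BombieriGubler2006, Thm. 12.5.12 (b) ⟹ (c)] -/
theorem polyGenSzpiro_of_polyStrongHall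
    (h : ∃ A C : ℝ, ∀ x y z : ℤ, IsPrimitiveHallSolution x y z →
      ((max (|x| ^ 3) |z| : ℤ) : ℝ) ≤ C * ((radical z.natAbs : ℕ) : ℝ) ^ A) :
    ∃ σ C : ℝ, ∀ W₀ : WeierstrassCurve ℤ, (W₀.baseChange ℚ).IsElliptic →
      (∀ v : HeightOneSpectrum ℤ, (W₀.baseChange ℚ).IsMinimalAt v) →
      ((max |W₀.Δ| (|W₀.c₄| ^ 3) : ℤ) : ℝ) ≤ C * ((W₀.baseChange ℚ).conductorNorm ℤ : ℝ) ^ σ :=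
  stub_polyGenSzpiro_of_polyStrongHall h

end Summit.ABC.ABC.Theorems.PolyHeightOfBoundedPrimes.MordellTwist

end
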